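import Summits.QuantumFields.YangMills.Theorems.PoincareLipschitzMonotonicityEqualityLetters
import Summits.QuantumFields.YangMills.Theorems.PoincareLipschitzRadialVariation
import HarnessLib

/-!
# Crux `BlockLipschitzL` (stmt-QuantumFields-23533) ∕ `HistoryTailL` (stmt-QuantumFields-19936), LINE 25 «CompactnessTransfer»,
# stub S1″ — the (TM) re-cut, file TM-C2 «MONOTONICITY EQUALITY ⇒ THE RADIAL DERIVATIVE VANISHES»

Cell `ym3-torus` (YM ladder rung R3 = continuum SU(2) Yang–Mills on T³ — a RUNG, NOT Clay: not d = 4, not infinite volume,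
not a mass gap); WIDTH helper seat `ym3-torus-px3` g9 (LEAD ★w1-19936 g10 «GO (TM)» 14:49:45Z); `--supports
stmt-QuantumFields-23533`; THEOREMS ONLY (0 `def`, 0 `sorry`, default heartbeats); imports TM-C1 ✓`…MonotonicityEqualityLetters`
(radial push-forward, profile FTC, negativity window of the cutoff derivative) + w2 g13's (δ1) ✓`PoincareLipschitzRadialVariation`
(★★★`radial_identity`, `sum_coord_sub_sq`).

WHAT THIS FILE DOES — the EQUALITY CASE of the monotonicity formula for ball minimisers [Simon1996, §2.4 ∕ §2.5]: for a unit
finite-energy `W^{1,2}` map `U` on an open `Ω ⊆ ℝ³` with weak gradient `G`, energy minimising on `B_R(y) ⊆ Ω` against finite-energy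
unit competitors agreeing with it off a smaller concentric ball, WHOSE BALL ENERGIES ARE LINEAR — `E(B_r(y)) = Θ·r` for `0 < r ≤ R`
(i.e. `r⁻¹E(B_r(y))` is CONSTANT) — the radial derivative vanishes: ★★★ `radialDeriv_ae_zero_of_ball_linear :
∀ᵐ x ∈ B_{R∕2}(y), Σᵢ (xᵢ − yᵢ)•G x eᵢ = 0` (`= G x (x − y)`, i.e. `∂_r U = 0`: `U` is homogeneous of degree zero about `y`).
Proof: (δ1)'s radial identity `∫(g(s)+2s·g′(s))·dens = (4∕τ²)∫ g′(s)·‖Σᵢ(xᵢ−yᵢ)•G eᵢ‖²` (`s = ‖x−y‖²∕τ²`) for the cutoff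
`g(s) = smoothTransition(1−s)`; its LEFT side VANISHES because the push-forward of `dens·dx` under `dist(·,y)` is `Θ·dr`
(TM-C1 ★★) and `∫₀^R (g(r²∕τ²) + 2(r²∕τ²)g′(r²∕τ²))dr = [r·g(r²∕τ²)]₀^R = 0` (`τ < R`); so `∫ g′(s)·ρ = 0` with `g′ ≤ 0`,
`ρ := ‖Σᵢ(xᵢ−yᵢ)•G eᵢ‖² ≥ 0`, whence `g′(s)·ρ = 0` a.e.; the cutoff derivative is NEGATIVE on a window `1 − s ∈ (j₁, j₂)`
(TM-C1 ★), and the windows for rational `τ < R` cover `0 < ‖x − y‖ < R∕2`.  ★ `radial_sq_le` records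
`‖Σᵢ(xᵢ−yᵢ)•G eᵢ‖² ≤ ‖x−y‖²·Σᵢ‖G eᵢ‖²` (Cauchy–Schwarz; integrability of `ρ`).
HONEST SCOPE.  One step (M=) of the (TM) re-cut; nothing of (TM), (ZD), (C), S1″, K1, `MeanDeviationL`, `BlockLipschitzL`,
`HistoryTailL` is proved here.  YM₃ on T³ is rung R3, not Clay; YM gap NOT proved; no summit statement is proved here.

References: L. Simon, Theorems on Regularity and Singularity of Energy Minimizing Maps (1996) [Simon1996] (§2.4 the monotonicity
identity with the radial term `2∫ R^{2−n}|∂_R u|²`, §2.5, §3.1 tangent maps are homogeneous); R. Schoen, K. Uhlenbeck,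
J. Differential Geom. 17 (1982) [SchoenUhlenbeck1982] (§2); P. Price, Manuscripta Math. 43 (1983) [Price1983].
-/

set_option autoImplicit false

noncomputable section

open scoped BigOperators Topology RealInnerProductSpace ContDiff
open MeasureTheory Set Filter Metric Function TopologicalSpace

namespace Summit.QuantumFields.YangMills.Theorems.PoincareLipschitzMonotonicityEquality

open Literature.Analysis.FunctionSpaces (HasWeakFDerivOn)
open Summit.QuantumFields.YangMills.Theorems.PoincareLipschitzRadialCutoffLetters (cutoff_contDiff cutoff_eq_zero
  cutoff_deriv_nonpos cutoff_deriv_continuous)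
open Summit.QuantumFields.YangMills.Theorems.PoincareLipschitzRadialVariation (radial_identity sum_coord_sub_sq)
open Summit.QuantumFields.YangMills.Theorems.PoincareLipschitzMonotonicityEqualityLetters

variable {F : Type*} [NormedAddCommGroup F] [InnerProductSpace ℝ F]

/-- ★ **CAUCHY–SCHWARZ FOR THE RADIAL SUM**: `‖Σᵢ (xᵢ − yᵢ)•vᵢ‖² ≤ ‖x − y‖²·Σᵢ ‖vᵢ‖²`. [folklore] -/
theorem radial_sq_le (x y : EuclideanSpace ℝ (Fin 3)) (v : Fin 3 → F) :
    ‖∑ i : Fin 3, (x i - y i) • v i‖ ^ 2 ≤ ‖x - y‖ ^ 2 * ∑ i : Fin 3, ‖v i‖ ^ 2 := by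
  have h1 : ‖∑ i : Fin 3, (x i - y i) • v i‖ ≤ ∑ i : Fin 3, |x i - y i| * ‖v i‖ := by
    refine (norm_sum_le _ _).trans (le_of_eq ?_)
    refine Finset.sum_congr rfl fun i _ => ?_
    rw [norm_smul, Real.norm_eq_abs]
  have h2 : (∑ i : Fin 3, |x i - y i| * ‖v i‖) ^ 2 ≤ (∑ i : Fin 3, |x i - y i| ^ 2) * ∑ i : Fin 3, ‖v i‖ ^ 2 :=
    Finset.sum_mul_sq_le_sq_mul_sq _ _ _
  have h3 : ∑ i : Fin 3, |x i - y i| ^ 2 = ‖x - y‖ ^ 2 := by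
    rw [← sum_coord_sub_sq]; exact Finset.sum_congr rfl fun i _ => sq_abs _
  have h0 : 0 ≤ ∑ i : Fin 3, |x i - y i| * ‖v i‖ := Finset.sum_nonneg fun i _ => by positivity
  calc ‖∑ i : Fin 3, (x i - y i) • v i‖ ^ 2 ≤ (∑ i : Fin 3, |x i - y i| * ‖v i‖) ^ 2 :=
        pow_le_pow_left₀ (norm_nonneg _) h1 2
    _ ≤ ‖x - y‖ ^ 2 * ∑ i : Fin 3, ‖v i‖ ^ 2 := by rw [← h3]; exact h2

/-- ★★★ **MONOTONICITY EQUALITY ⇒ THE RADIAL DERIVATIVE VANISHES.**  Let `U` be weakly differentiable on the open `Ω ⊆ ℝ³`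
with weak gradient `G`, unit on `Ω`, of finite energy, energy minimising on the ball `B_R(y) ⊆ Ω` among finite-energy unit
`W^{1,2}(Ω)` competitors agreeing with `U` off a smaller concentric ball ([Simon1996, §2.1]; the `hmin` row of (γ)∕(δ1)), and
suppose the ball energies are LINEAR: `∫_{B_r(y)} Σᵢ‖G eᵢ‖² = Θ·r` for all `0 < r ≤ R`.  Then `Σᵢ (xᵢ − yᵢ)•G x eᵢ = 0` for
a.e. `x ∈ B_{R∕2}(y)` — the equality case of the monotonicity formula: `U` is radially constant about `y`.
[cite: Simon1996, §2.4 and §2.5 (monotonicity identity, radial term), §3.1; SchoenUhlenbeck1982, §2; Price1983, §1] -/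
theorem radialDeriv_ae_zero_of_ball_linear {Ω : Opens (EuclideanSpace ℝ (Fin 3))}
    {U : EuclideanSpace ℝ (Fin 3) → F} {G : EuclideanSpace ℝ (Fin 3) → EuclideanSpace ℝ (Fin 3) →L[ℝ] F}
    (hU : HasWeakFDerivOn Ω volume U G) (hU1 : ∀ x ∈ (Ω : Set (EuclideanSpace ℝ (Fin 3))), ‖U x‖ = 1)
    (hGi : IntegrableOn (fun x => ∑ i : Fin 3, ‖G x (EuclideanSpace.single i (1:ℝ))‖ ^ 2) (Ω : Set _) volume)
    {y : EuclideanSpace ℝ (Fin 3)} {R : ℝ} (hR : 0 < R) (hB : ball y R ⊆ (Ω : Set _))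
    (hmin : ∀ (W : EuclideanSpace ℝ (Fin 3) → F) (GW : EuclideanSpace ℝ (Fin 3) → EuclideanSpace ℝ (Fin 3) →L[ℝ] F),
      HasWeakFDerivOn Ω volume W GW → (∀ x ∈ (Ω : Set (EuclideanSpace ℝ (Fin 3))), ‖W x‖ = 1) →
      IntegrableOn (fun x => ∑ i : Fin 3, ‖GW x (EuclideanSpace.single i (1:ℝ))‖ ^ 2) (Ω : Set _) volume →
      (∃ ρ'' : ℝ, ρ'' < R ∧ ∀ x, x ∉ ball y ρ'' → W x = U x) →
      ∫ x in ball y R, ∑ i : Fin 3, ‖G x (EuclideanSpace.single i (1:ℝ))‖ ^ 2 ≤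
        ∫ x in ball y R, ∑ i : Fin 3, ‖GW x (EuclideanSpace.single i (1:ℝ))‖ ^ 2)
    {Θ : ℝ} (hE : ∀ r : ℝ, 0 < r → r ≤ R →
      ∫ x in ball y r, ∑ i : Fin 3, ‖G x (EuclideanSpace.single i (1:ℝ))‖ ^ 2 = Θ * r) :
    ∀ᵐ x ∂(volume.restrict (ball y (R / 2))),
      (∑ i : Fin 3, (x i - y i) • G x (EuclideanSpace.single i (1:ℝ))) = 0 := by
  -- the cutoff profile `g(s) = smoothTransition((1 - s)/1)` and its letters
  set g : ℝ → ℝ := fun s => Real.smoothTransition ((1 - s) / 1) with hg_def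
  have hg : ContDiff ℝ ∞ g := cutoff_contDiff 1
  have hg1 : ContDiff ℝ 1 g := cutoff_contDiff 1
  have hg0 : ∀ s : ℝ, 1 ≤ s → g s = 0 := fun s hs => cutoff_eq_zero one_pos hs
  have hg'le : ∀ s : ℝ, deriv g s ≤ 0 := cutoff_deriv_nonpos one_pos
  have hg'c : Continuous (deriv g) := cutoff_deriv_continuous 1
  obtain ⟨M, hM0, hM⟩ := exists_bound_cutoff_one_deriv
  obtain ⟨j₁, j₂, hj₁, hj₁₂, hj₂, hneg⟩ := exists_window_cutoff_deriv_neg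
  -- shorthand facts
  have hdens0 : ∀ x, 0 ≤ ∑ i : Fin 3, ‖G x (EuclideanSpace.single i (1:ℝ))‖ ^ 2 :=
    fun x => Finset.sum_nonneg fun i _ => by positivity
  have hGiB : IntegrableOn (fun x => ∑ i : Fin 3, ‖G x (EuclideanSpace.single i (1:ℝ))‖ ^ 2) (ball y R) volume :=
    hGi.mono_set hB
  -- measurability of the radial sum
  have hGm : AEStronglyMeasurable G (volume.restrict (ball y R)) :=
    (hU.locallyIntegrableOn_deriv.aestronglyMeasurable).mono_measure (Measure.restrict_mono hB le_rfl)
  have hsum : AEStronglyMeasurable (fun x => ∑ i : Fin 3, (x i - y i) • G x (EuclideanSpace.single i (1:ℝ)))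
      (volume.restrict (ball y R)) := by
    refine Finset.aestronglyMeasurable_sum (Finset.univ : Finset (Fin 3))
      (f := fun (i : Fin 3) (x : EuclideanSpace ℝ (Fin 3)) => (x i - y i) • G x (EuclideanSpace.single i (1:ℝ))) fun i _ => ?_
    have h1 : AEStronglyMeasurable (fun x => G x (EuclideanSpace.single i (1:ℝ))) (volume.restrict (ball y R)) :=
      (ContinuousLinearMap.apply ℝ F (EuclideanSpace.single i (1:ℝ))).continuous.comp_aestronglyMeasurable hGm
    have h2 : Continuous fun x : EuclideanSpace ℝ (Fin 3) => x i - y i :=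
      (EuclideanSpace.proj i).continuous.sub continuous_const
    exact h2.aestronglyMeasurable.smul h1
  have hρm : AEStronglyMeasurable (fun x => ‖∑ i : Fin 3, (x i - y i) • G x (EuclideanSpace.single i (1:ℝ))‖ ^ 2)
      (volume.restrict (ball y R)) := hsum.norm.pow 2
  -- integrability of `ρ` on `B_R(y)`
  have hρi : Integrable (fun x => ‖∑ i : Fin 3, (x i - y i) • G x (EuclideanSpace.single i (1:ℝ))‖ ^ 2)
      (volume.restrict (ball y R)) := by
    refine Integrable.mono' (hGiB.const_mul (R ^ 2)) hρm ?_
    filter_upwards [ae_restrict_mem measurableSet_ball] with x hx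
    rw [Real.norm_eq_abs, abs_of_nonneg (by positivity)]
    have hxy : ‖x - y‖ ^ 2 ≤ R ^ 2 := by
      have := mem_ball.1 hx; rw [dist_eq_norm] at this
      exact pow_le_pow_left₀ (norm_nonneg _) this.le 2
    calc ‖∑ i : Fin 3, (x i - y i) • G x (EuclideanSpace.single i (1:ℝ))‖ ^ 2
        ≤ ‖x - y‖ ^ 2 * ∑ i : Fin 3, ‖G x (EuclideanSpace.single i (1:ℝ))‖ ^ 2 := radial_sq_le x y _
      _ ≤ R ^ 2 * ∑ i : Fin 3, ‖G x (EuclideanSpace.single i (1:ℝ))‖ ^ 2 := mul_le_mul_of_nonneg_right hxy (hdens0 x)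
  -- Step A: the right side of the radial identity vanishes for every `0 < τ < R`
  have stepA : ∀ τ : ℝ, 0 < τ → τ < R →
      ∫ x in ball y R, deriv g (‖x - y‖ ^ 2 / τ ^ 2) *
        ‖∑ i : Fin 3, (x i - y i) • G x (EuclideanSpace.single i (1:ℝ))‖ ^ 2 = 0 := by
    intro τ hτ hτR
    have hid := radial_identity hU hU1 hGi hB hmin hg hg0 hτ hτR
    -- the left side is `Θ · ∫₀^R profile = 0`
    have hk : Continuous fun r : ℝ => g (r ^ 2 / τ ^ 2) + 2 * (r ^ 2 / τ ^ 2) * deriv g (r ^ 2 / τ ^ 2) := by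
      have hc1 : Continuous (fun r : ℝ => r ^ 2 / τ ^ 2) := (continuous_pow 2).div_const _
      exact (hg.continuous.comp hc1).add ((continuous_const.mul hc1).mul (hg'c.comp hc1))
    have hpush := setIntegral_radial_mul_eq_of_ball_linear hR hdens0 hGiB hE hk
    simp_rw [dist_eq_norm] at hpush
    rw [intervalIntegral_profile_eq_zero hg1 hg0 hτ hτR, mul_zero] at hpush
    rw [hpush] at hid
    have h4 : (4 : ℝ) / τ ^ 2 ≠ 0 := by positivity
    exact (mul_eq_zero.1 hid.symm).resolve_left h4
  -- Step B: the integrand is `≤ 0`, so it vanishes a.e. on `B_R(y)`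
  have stepB : ∀ τ : ℝ, 0 < τ → τ < R → ∀ᵐ x ∂(volume.restrict (ball y R)),
      deriv g (‖x - y‖ ^ 2 / τ ^ 2) * ‖∑ i : Fin 3, (x i - y i) • G x (EuclideanSpace.single i (1:ℝ))‖ ^ 2 = 0 := by
    intro τ hτ hτR
    have hsm : AEStronglyMeasurable (fun x : EuclideanSpace ℝ (Fin 3) => deriv g (‖x - y‖ ^ 2 / τ ^ 2))
        (volume.restrict (ball y R)) :=
      (hg'c.comp (((continuous_id.sub continuous_const).norm.pow 2).div_const _)).aestronglyMeasurable
    have hint : Integrable (fun x => deriv g (‖x - y‖ ^ 2 / τ ^ 2) *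
        ‖∑ i : Fin 3, (x i - y i) • G x (EuclideanSpace.single i (1:ℝ))‖ ^ 2) (volume.restrict (ball y R)) :=
      hρi.bdd_mul hsm (ae_of_all _ fun x => by rw [Real.norm_eq_abs]; exact hM _)
    have hnn : 0 ≤ᵐ[volume.restrict (ball y R)] fun x => -(deriv g (‖x - y‖ ^ 2 / τ ^ 2) *
        ‖∑ i : Fin 3, (x i - y i) • G x (EuclideanSpace.single i (1:ℝ))‖ ^ 2) :=
      ae_of_all _ fun x => neg_nonneg.2 (mul_nonpos_of_nonpos_of_nonneg (hg'le _) (by positivity))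
    have h0 : ∫ x in ball y R, -(deriv g (‖x - y‖ ^ 2 / τ ^ 2) *
        ‖∑ i : Fin 3, (x i - y i) • G x (EuclideanSpace.single i (1:ℝ))‖ ^ 2) = 0 := by
      rw [integral_neg, stepA τ hτ hτR, neg_zero]
    have hae := (integral_eq_zero_iff_of_nonneg_ae hnn hint.neg).1 h0
    filter_upwards [hae] with x hx
    simpa using hx
  -- Step C: all rational scales at once
  have stepC : ∀ᵐ x ∂(volume.restrict (ball y R)), ∀ q : ℚ, (0 < (q : ℝ) ∧ (q : ℝ) < R) →
      deriv g (‖x - y‖ ^ 2 / (q : ℝ) ^ 2) * ‖∑ i : Fin 3, (x i - y i) • G x (EuclideanSpace.single i (1:ℝ))‖ ^ 2 = 0 := by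
    rw [ae_all_iff]
    intro q
    by_cases hq : 0 < (q : ℝ) ∧ (q : ℝ) < R
    · filter_upwards [stepB q hq.1 hq.2] with x hx _ using hx
    · exact ae_of_all _ fun x h => absurd h hq
  -- Step D: the windows for rational scales cover `0 < ‖x - y‖ < R/2`
  have hsub : ball y (R / 2) ⊆ ball y R := ball_subset_ball (by linarith)
  have stepC' := ae_restrict_of_ae_restrict_of_subset hsub stepC
  filter_upwards [stepC', ae_restrict_mem measurableSet_ball] with x hx hxB
  by_cases hxy : x - y = 0
  · have : ∀ i : Fin 3, x i - y i = 0 := fun i => by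
      have := congrArg (fun v : EuclideanSpace ℝ (Fin 3) => v i) hxy; simpa using this
    simp [this]
  · -- the radius and the window constants
    set r : ℝ := ‖x - y‖ with hr_def
    have hr0 : 0 < r := norm_pos_iff.2 hxy
    have hrR : r < R / 2 := by have := mem_ball.1 hxB; rwa [dist_eq_norm] at this
    set α : ℝ := Real.sqrt (1 - j₂) with hα_def
    set β : ℝ := Real.sqrt (1 - j₁) with hβ_def
    have hα2 : α ^ 2 = 1 - j₂ := Real.sq_sqrt (by linarith)
    have hβ2 : β ^ 2 = 1 - j₁ := Real.sq_sqrt (by linarith)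
    have hα0 : 0 < α := Real.sqrt_pos.2 (by linarith)
    have hβ0 : 0 < β := Real.sqrt_pos.2 (by linarith)
    have hαβ : α < β := by nlinarith
    have hβhalf : 1 / 2 < β := by nlinarith
    -- a rational scale in the window
    have hlt : r / β < min (r / α) R := by
      refine lt_min ?_ ?_
      · exact div_lt_div_of_pos_left hr0 hα0 hαβ
      · rw [div_lt_iff₀ hβ0]; nlinarith
    obtain ⟨q, hq1, hq2⟩ := exists_rat_btwn hlt
    have hq0 : 0 < (q : ℝ) := lt_trans (div_pos hr0 hβ0) hq1
    have hqR : (q : ℝ) < R := lt_of_lt_of_le hq2 (min_le_right _ _)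
    have hqα : (q : ℝ) < r / α := lt_of_lt_of_le hq2 (min_le_left _ _)
    have h := hx q ⟨hq0, hqR⟩
    -- the scale `q` puts `s = r²/q²` in the negativity window
    have hs1 : j₁ < 1 - r ^ 2 / (q : ℝ) ^ 2 := by
      have h1 : r < β * q := by rwa [div_lt_iff₀ hβ0, mul_comm] at hq1
      have h2 : r ^ 2 < β ^ 2 * (q : ℝ) ^ 2 := by nlinarith [mul_pos (sub_pos.2 h1) (add_pos hr0 (mul_pos hβ0 hq0))]
      rw [hβ2] at h2
      have h3 : r ^ 2 / (q : ℝ) ^ 2 < 1 - j₁ := by rw [div_lt_iff₀ (by positivity)]; linarith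
      linarith
    have hs2 : 1 - r ^ 2 / (q : ℝ) ^ 2 < j₂ := by
      have h1 : α * q < r := by rwa [lt_div_iff₀ hα0, mul_comm] at hqα
      have h2 : α ^ 2 * (q : ℝ) ^ 2 < r ^ 2 := by nlinarith [mul_pos (sub_pos.2 h1) (add_pos hr0 (mul_pos hα0 hq0))]
      rw [hα2] at h2
      have h3 : 1 - j₂ < r ^ 2 / (q : ℝ) ^ 2 := by rw [lt_div_iff₀ (by positivity)]; linarith
      linarith
    have hd : deriv g (r ^ 2 / (q : ℝ) ^ 2) < 0 := hneg _ hs1 hs2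
    have hρ0 : ‖∑ i : Fin 3, (x i - y i) • G x (EuclideanSpace.single i (1:ℝ))‖ ^ 2 = 0 :=
      (mul_eq_zero.1 h).resolve_left hd.ne
    exact norm_eq_zero.1 (pow_eq_zero_iff two_ne_zero |>.1 hρ0)

end Summit.QuantumFields.YangMills.Theorems.PoincareLipschitzMonotonicityEquality

end
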